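import Summits.QuantumFields.YangMills.Theorems.BalabanUVNodesN06SectBStepUParKnitAt
import Summits.QuantumFields.YangMills.Theorems.BalabanUVNodesN06SectBStepUParKnitRecordKC

/-!
# Balaban UV-stability nodes, N06 [B9] Sect. B — «K2-G-KNIT-N» (2∕3): THE KNIT SECT.-B STEP OF RECORD FOR EVERY `N` — the LOCATED-RANGE `hN : N ≤ 25` of
# `sectBStepUPar_knitRecord` ∕ `sectBStepUPar_knitRecordKC` (the knit certificate's `hBK` supplier, KE₃X) REPLACED by two x-free α-windows

[B9] = T. Bałaban, *Propagators for lattice gauge theories in a background field*, Commun. Math. Phys. **99** (1985) 389–434 [`Balaban1985BackgroundPropagators`];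
[5] = T. Bałaban, *Averaging operations for lattice gauge theories*, Commun. Math. Phys. **98** (1985) 17–51 [`Balaban1985Averaging`]; [4] = [`Balaban1984PropagatorsII`].

statement-level skeleton of published theorems with citation tags; proofs where landed; nothing here is a claim about the Yang–Mills mass gap

THE PRINT.  Thm 3.4 p. 400; (3.19) p. 393; [5] Prop. 2 p. 26 — print's Sect.-B step is stated for `SU(N)`, any `N`; the tree's cap `N ≦ 25` came from asking closure of `SU(N)`
under ALL block averages (`AvgClosed`), which fails at `N ≧ 26` (`B7Prop2SpecialUnitary.not_avgClosed_specialUnitary`), whereas [5] Prop. 2 only needs closure AT THE RADIUS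
the (3.35)-regular averages reach — `AvgClosedAt (d+1) t (ℓ+1) SU(N)` for `t ≤ 1∕4`, `N·t < π` (`avgClosedAt_specialUnitary`), with `t := 32((d+1)+1)((d+1)+4)(ℓ+1)²α₀′`
(dag-n06-l, `B9Eq3124HZKnitPairReg335YMemG` edition 2, ✓ 2026-08-31).

WHAT (seat dag-n06-c gen 27; cell `pub-ymgap`, HUMAN RULING D-0062, Track A node N06).  Three verbatim re-readings: §1 ★ `sectBStepUPar_knitAt` = `N06SectBStepUParKnitFull.
sectBStepUPar_knit` with `hGa : AvgClosedAt (d+1) t (ℓ+1) G` + `hαt` (over `N06SectBStepUParKnitAt.sectBStepUPar_knit_of_lawsAt`); §2 ★★★ `sectBStepUPar_knitRecordN` =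
`N06SectBStepUParKnitRecord.sectBStepUPar_knitRecord` with `hN : N ≤ 25` REPLACED by `hα4N : 32((d+1)+1)((d+1)+4)(ℓ+1)²α₀′ ≤ 1∕4`, `hαπN : N·(32((d+1)+1)((d+1)+4)(ℓ+1)²α₀′) < π`
(`hGa := avgClosedAt_specialUnitary (d+1) (ℓ+1) hα4N hαπN`, `hαt := le_rfl`); ★★★ `sectBStepUPar_knitRecordKCN` = `N06SectBStepUParKnitRecordKC.sectBStepUPar_knitRecordKC` (the
certificate-currency `hBK` supplier: `hunitA` from `hΔAK` via `hP1` + `isUnit_of_posDefTr`, `hKpl` from `hKplK`) likewise, at the certificate's `α₀K`.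

CONSUMER RECIPE («KE₄X», dag-n06-d): `hBK := fun h32 h33 => …N06SectBStepUParKnitRecordN.sectBStepUPar_knitRecordKCN (instNE := fun x => B9Thm39ReadingCoords.bondIdx_nonempty _)
θ.toStage3Params Mstar f bR ιB C38 CqK MK aInv hι M₂ hM₂ hrepr hcR hcL hCqK MInv aW hMInv haInv haW c hP1 MR (q.a₁ ∕ c) hΔAK hMRI haIR hαK hαQK hα8 hα4N hαπN hKplK haIK hϱ' hϱ hsmall'
hc₃' hϱ'1 hEc hdX hsmall hc₃ hMd mN hnbr hMr h32 h33` — versus KE₃X: `hN` and `[∀ x, Nonempty (geo9Y x).Site]` DROPPED, `hα4N hαπN` (at `α₀K`) ADDED.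

HONEST SCOPE.  Instantiation ∕ bookkeeping of landed theorems; conditional on `hΔAK`, `h32`, `h33` and the numerics; a HELPER by key 27364 — NOT the discharge of any N06 obligation;
count-neutral; nothing continuum ∕ OS ∕ mass gap ∕ Clay.  2026-08-31.
-/

noncomputable section

namespace Summit.QuantumFields.YangMills.BalabanUVNodes.N06SectBStepUParKnitRecordN

open scoped Matrix Matrix.Norms.L2Operator
open Literature.MathematicalPhysics.QuantumFieldTheory.Balaban1983to89
open Literature.MathematicalPhysics.QuantumFieldTheory.Balaban1983to89.Node00 (SiteY BlkY FBondY IBondY CfgY SiteParY GAQY GpY XY deltaAQY deltaPrimeAY parSymY parBY)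
open Literature.MathematicalPhysics.QuantumFieldTheory.Balaban1983to89.Node00.OpsYQLetter (adjTrY)
open Literature.MathematicalPhysics.QuantumFieldTheory.Balaban1983to89.B6Ineq2142KLevelV1 (β)
open Literature.MathematicalPhysics.QuantumFieldTheory.Balaban1983to89.B6GlobalChartV1 (PV)
open Literature.MathematicalPhysics.QuantumFieldTheory.Balaban1983to89.B6KLevelCensusIndexV1 (KIdx kGeo)
open Literature.MathematicalPhysics.QuantumFieldTheory.Balaban1983to89.B6RandomWalk (HasMajorant Ineq261)
open Literature.MathematicalPhysics.QuantumFieldTheory.Balaban1983to89.B6RandomWalkL2 (HasL2Majorant)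
open Literature.MathematicalPhysics.QuantumFieldTheory.Balaban1983to89.B9Thm34Ext (toB6)
open Literature.MathematicalPhysics.QuantumFieldTheory.Balaban1983to89.B9PinMembersKLevelV1 (MemberY geo9Y)
open Literature.MathematicalPhysics.QuantumFieldTheory.Balaban1983to89.B9BackgroundsKLevelV1P (bg9KP)
open Literature.MathematicalPhysics.QuantumFieldTheory.Balaban1983to89.B9SectBCodedClassR (RegExtraY bg9YC extraYPb)
open Literature.MathematicalPhysics.QuantumFieldTheory.Balaban1983to89.B9Eq360DeltaPrimeAY (AfldY)
open Literature.MathematicalPhysics.QuantumFieldTheory.Balaban1983to89.B9SectBGpLettersY (GVal blkC)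
open Literature.MathematicalPhysics.QuantumFieldTheory.Balaban1983to89.B9SectBGpFrameCodedYR (codingYx)
open Literature.MathematicalPhysics.QuantumFieldTheory.Balaban1983to89.B9SectBCodedReadingsUR (KACU)
open Literature.MathematicalPhysics.QuantumFieldTheory.Balaban1983to89.B9SectBCodedReadingsUParH (KSCUPar SectBStepUPar)
open Literature.MathematicalPhysics.QuantumFieldTheory.Balaban1983to89.B9SectBKerFrameCodedYR (CinvY)
open Literature.MathematicalPhysics.QuantumFieldTheory.Balaban1983to89.B9RWSumsReadsNbr (nbr)
open Literature.MathematicalPhysics.QuantumFieldTheory.Balaban1983to89.B9Eq340TaxiContourLocalityY (rLB)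
open Literature.MathematicalPhysics.QuantumFieldTheory.Balaban1983to89.B9SectBCodedClassKnitY (C37KY regDatum_of_C37KY cplx337_of_C37KY le_of_C37KY)
open Literature.MathematicalPhysics.QuantumFieldTheory.Balaban1983to89.B9SectBQVarLawsOfKernelY (endBlock_small_of_cplx337)
open Literature.MathematicalPhysics.QuantumFieldTheory.Balaban1983to89.B7Prop2Explicit (unitaryUnits AvgClosed C0 c2')
open Literature.MathematicalPhysics.QuantumFieldTheory.Balaban1983to89.B7Prop3Flat (c3)
open Literature.MathematicalPhysics.QuantumFieldTheory.Balaban1983to89.B7Prop5CplxLevels (epsCplx tauCplx)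
open Literature.MathematicalPhysics.QuantumFieldTheory.Balaban1983to89.B5Eq118OneStroke (iterBlockOf)
open Literature.MathematicalPhysics.QuantumFieldTheory.Balaban1983to89.B9Eq316AveragingTransposeZd (alphaQ)
open Literature.MathematicalPhysics.QuantumFieldTheory.Balaban1983to89.B9Eq3115KnitLetterY (QknitY)
open Literature.MathematicalPhysics.QuantumFieldTheory.Balaban1983to89.B9C2FormBoxRegimeY (Kpl)
open Literature.MathematicalPhysics.QuantumFieldTheory.Balaban1983to89.B9B8KnitColumnFlatness (windows_of_alphaQ)
open Literature.MathematicalPhysics.QuantumFieldTheory.Balaban1983to89.B9B8AveragingJunction (parKnitY)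
open Summit.QuantumFields.YangMills.BalabanUVNodes.N06SectBQVarLawsKnit (hQ80_knit hQL280_knit)
open Summit.QuantumFields.YangMills.BalabanUVNodes.N06SectBStepUParKnit (sectBStepUPar_knit_of_laws)
open Literature.MathematicalPhysics.QuantumFieldTheory.Balaban1983to89.Node00 (SiteY BlkY FBondY IBondY CfgY SiteParY GAQY GpY XY deltaAQY deltaPrimeAY parSymY parBY
  kernelFamilyS kernelFamilyB Stage3Params)
open Literature.MathematicalPhysics.QuantumFieldTheory.Balaban1983to89.Node00.OpsYQLetter (adjTrY qKnitOfRecord qsKnitOfRecord)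
open Literature.MathematicalPhysics.QuantumFieldTheory.Balaban1983to89.Node00 (cqY)
open Literature.MathematicalPhysics.QuantumFieldTheory.Balaban1983to89.B9PinGeometryKLevelV1 (c35Y)
open Literature.MathematicalPhysics.QuantumFieldTheory.Balaban1983to89.B9PinGeometryKLevelV1B (c35Y_le_ten)
open Literature.MathematicalPhysics.QuantumFieldTheory.Balaban1983to89.B9SectBCodedClassKnitY (C37KY)
open Literature.MathematicalPhysics.QuantumFieldTheory.Balaban1983to89.B7Prop2Explicit (unitaryUnits c2')
open Literature.MathematicalPhysics.QuantumFieldTheory.Balaban1983to89.B7Prop2SpecialUnitary (specialUnitaryUnits specialUnitaryUnits_le_unitaryUnits)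
open Literature.MathematicalPhysics.QuantumFieldTheory.Balaban1983to89.B7AvgClosedSpecialUnitarySharp (avgClosed_specialUnitary_of_le)
open Literature.MathematicalPhysics.QuantumFieldTheory.Balaban1983to89.B9LeafXCodedKnitUParH (thm33Printed_codedUPar)
open Summit.QuantumFields.YangMills.BalabanUVNodes.N06SectBStepUParKnitFull (sectBStepUPar_knit)
open Literature.MathematicalPhysics.QuantumFieldTheory.Balaban1983to89.B9BackgroundsKLevelV1R (RegFamY bg9YR regYP335)
open Literature.MathematicalPhysics.QuantumFieldTheory.Balaban1983to89.B9LeafXClassAntitone (ClassIncl)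
open Literature.MathematicalPhysics.QuantumFieldTheory.Balaban1983to89.B9SectBCodedClassR (regC335 classIncl_regC335Pb_regYPb335)
open Literature.MathematicalPhysics.QuantumFieldTheory.Balaban1983to89.B9Thm311ReadingCoords (PosDefTr IsSymmTr isUnit_of_posDefTr)
open Literature.MathematicalPhysics.QuantumFieldTheory.Balaban1983to89.B7Prop2Explicit (C0)
open Summit.QuantumFields.YangMills.BalabanUVNodes.N06SectBStepUParKnitRecord (sectBStepUPar_knitRecord)
open Literature.MathematicalPhysics.QuantumFieldTheory.Balaban1983to89.B7Prop2SpecialUnitary (AvgClosedAt avgClosedAt_specialUnitary)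
open Summit.QuantumFields.YangMills.BalabanUVNodes.N06SectBStepUParKnitAt (sectBStepUPar_knit_of_lawsAt)
open Summit.QuantumFields.YangMills.BalabanUVNodes.N06SectBStepUParKnitFull (hC37R_of_C37KY hC37A_of_C37KY hC37ϱ_of_C37KY)

/-! ## §1 The `AvgClosedAt` edition of `sectBStepUPar_knit` -/

section Full

variable {d ℓ : ℕ} {hd : 1 ≤ d + 1} {hL : Odd (ℓ + 1) ∧ 1 < ℓ + 1} {b₀ b₁ : ℝ}
variable {N : ℕ} [Nonempty (Fin N)] {ι : Type} [Fintype ι] [DecidableEq ι]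
variable {Mstar : ℕ} {J : Type} (f : J → MemberY d ℓ hd hL b₀ b₁ Mstar)
  [∀ x : MemberY d ℓ hd hL b₀ b₁ Mstar, Fintype (geo9Y x).Site]
  [instDS : ∀ x : MemberY d ℓ hd hL b₀ b₁ Mstar, DecidableEq (geo9Y x).Site] [instNE : ∀ x : MemberY d ℓ hd hL b₀ b₁ Mstar, Nonempty (geo9Y x).Site]
  (c35 : ℝ) (G : Subgroup (Matrix (Fin N) (Fin N) ℂ)ˣ) (P : RegExtraY d ℓ hd hL b₀ b₁ Mstar (Matrix (Fin N) (Fin N) ℂ))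
  (𝔮 : ∀ j : J, CfgY (Matrix (Fin N) (Fin N) ℂ) (f j).toKIdx → ((FBondY (f j).toKIdx → Matrix (Fin N) (Fin N) ℂ) →ₗ[ℂ] (IBondY (f j).toKIdx → Matrix (Fin N) (Fin N) ℂ)))
  (𝔮s : ∀ j : J, CfgY (Matrix (Fin N) (Fin N) ℂ) (f j).toKIdx → ((IBondY (f j).toKIdx → Matrix (Fin N) (Fin N) ℂ) →ₗ[ℂ] (FBondY (f j).toKIdx → Matrix (Fin N) (Fin N) ℂ)))
  (b : Module.Basis ι ℝ (Matrix (Fin N) (Fin N) ℂ)) (ιB : ∀ j : J, BlkY (f j).toKIdx → IBondY (f j).toKIdx)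
  (C38 : ∀ j : J, ℝ → CfgY (Matrix (Fin N) (Fin N) ℂ) (f j).toKIdx → AfldY (Matrix (Fin N) (Fin N) ℂ) (f j).toKIdx → Prop)
  (Cq CqK MK aInv β₀ : ℝ)


/-- ★★★ **(«K2-G-KNIT-N», `AvgClosedAt` EDITION of `N06SectBStepUParKnitFull.sectBStepUPar_knit`: `hGa : AvgClosedAt (d+1) t (ℓ+1) G` + the window `hαt`, proof verbatim over `sectBStepUPar_knit_of_lawsAt`) THE TWO-TRANSPORTER SECT.-B STEP OVER THE CODED CARRIER AT `(parA, parH) := (parKnitY, parSymY)`, `G[𝔮]` AT THE KNIT PAIR, CLASS `C37KY` PINNED TO THE CODED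
REGULARITY, `P := extraYPb`, `𝔸 = M_N(ℂ)` — EVERY LAW THE TREE HOLDS DISCHARGED**: `sectBStepUPar_knit_of_laws` (companion file: `hsym hparG hunitG hunitXG hC37 hparC hC37G hQ15
hQL2 hreg335P hplaq (d261,h261)` discharged) with, in addition, `hQ80 := N06SectBQVarLawsKnit.hQ80_knit` and `hQL280 := N06SectBQVarLawsKnit.hQL280_knit` (dag-n06-l, [B8] Prop. 7)
fed by §1's three projections of the class (`cA := L⁻³`).  DISPLAYED: `hι`, `hGa hGU`, basis data `M₂ hrepr hcR hcL`, knit faces `h𝔮 h𝔮s`, the numerics windows (`hMInv haInv haW hc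
hRP hα' hαQ hα8 hKpl`, `hϱ' hϱ hsmall' hc₃' hϱ'1 hE hdX hsmall hc₃`, `hMd hMr mN hnbr`), the class constants (`hCqK`, `hβ₀ : 3·L⁻³·β₀ ≦ ϱ′`), the GUARDED knit Thm 3.11 unit
`hunitA`, `hb₁`, the record's Thm 3.2 `h32`, the coded Thm 3.3 `h33`.
[cite: Balaban1985BackgroundPropagators, Thm 3.4 p.400, Sect. B pp.400–407, (3.19) p.393, (3.35)–(3.37) p.396, (3.80)–(3.81) p.406, Thms 3.1–3.3 pp.397–399, Thm 3.11 p.416; Balaban1985Averaging, Prop. 2 p.26, Prop. 7 p.43; Balaban1984PropagatorsII, Lemma 2.1 p.234, (2.51) p.232] -/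
theorem sectBStepUPar_knitAt [NormOneClass (Matrix (Fin N) (Fin N) ℂ)] [FiniteDimensional ℝ (Matrix (Fin N) (Fin N) ℂ)]
    (hι : ∀ (j : J) (s : BlkY (f j).toKIdx), β (f j).toKIdx.hN (f j).toKIdx.D (f j).toKIdx.hk (ιB j s) = s)
    {t : ℝ} (hGa : AvgClosedAt (d + 1) t (ℓ + 1) G) (hGU : G ≤ unitaryUnits (Matrix (Fin N) (Fin N) ℂ))
    (M₂ : ℝ) (hM₂ : 0 ≤ M₂) (hrepr : ∀ (v : Matrix (Fin N) (Fin N) ℂ) (j : ι), |b.repr v j| ≤ M₂ * ‖v‖) (hcR : 0 < M₂ * ∑ j, ‖b j‖)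
    (hcL : 0 < Real.sqrt (Fintype.card ι) * M₂ * ∑ j, ‖b j‖)
    (h𝔮 : ∀ (j : J) (U : CfgY (Matrix (Fin N) (Fin N) ℂ) (f j).toKIdx), 𝔮 j U = QknitY (f j).toKIdx U)
    (h𝔮s : ∀ (j : J) (U : CfgY (Matrix (Fin N) (Fin N) ℂ) (f j).toKIdx), 𝔮s j U = adjTrY (QknitY (f j).toKIdx U))
    (hCqK : 0 ≤ CqK)
    (MInv aW : ℝ) (hMInv : 0 < MInv) (haInv : 0 < aInv) (haW : 0 < aW) {c₀ : ℝ} (hc : c₀ ≤ 10)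
    (hRP : ∀ (j : J) (α₀ : ℝ) (U : CfgY (Matrix (Fin N) (Fin N) ℂ) (f j).toKIdx),
      (bg9YC (Matrix (Fin N) (Fin N) ℂ) G (extraYPb (Matrix (Fin N) (Fin N) ℂ) G) (f j)).Reg335 c35 α₀ U →
        (bg9KP (Matrix (Fin N) (Fin N) ℂ) G (f j).toKIdx).Reg335 c₀ α₀ U)
    {α₀' : ℝ} (hα' : 0 < α₀') (hαQ : α₀' ≤ alphaQ (d + 1) (ℓ + 1)) (hαt : 32 * (((d + 1 : ℕ) : ℝ) + 1) * ((d + 1 : ℕ) + 4) * (((ℓ + 1 : ℕ) : ℝ)) ^ 2 * α₀' ≤ t) (hα8 : 8 * α₀' ≤ c2' (d + 1) (ℓ + 1))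
    (hKpl : ∀ (j : J) (a : ℝ), 0 ≤ a → a ≤ aInv → Kpl (f j).toKIdx a * (kGeo (f j).toKIdx).L ^ 4 < α₀')
    -- the x-free Prop-7∕Prop-5 window of `B9Eq380QknitVariationY` (dag-n06-l)
    {ϱ' ϱ : ℝ} (hϱ' : 0 < ϱ') (hϱ : 0 < ϱ)
    (hsmall' : Real.exp (4 * (800 * (((d + 1 : ℕ) : ℝ) + 1) ^ 2 * (((d + 1 : ℕ) : ℝ) + 4)) * α₀')
      * (1 + 8 * (131072 * (((d + 1 : ℕ) : ℝ) + 1) ^ 2) * ϱ') ≤ 2)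
    (hc₃' : 2 * ϱ' ≤ c3 (d + 1) (ℓ + 1)) (hϱ'1 : 409600 * (((d + 1 : ℕ) : ℝ) + 1) ^ 2 * ϱ' ≤ 1)
    (hE : epsCplx (d + 1) (ℓ + 1) ϱ' 0 ≤ 1 / 16)
    (hdX : ((d + 1 : ℕ) : ℝ) * (epsCplx (d + 1) (ℓ + 1) ϱ' 0 + tauCplx (d + 1) (ℓ + 1) α₀' 0 ϱ' 0) ≤ 1 / 16)
    (hsmall : Real.exp (4480 * (((d + 1 : ℕ) : ℝ) + 1) ^ 2 * (((d + 1 : ℕ) : ℝ) + 4) * α₀' + 240000 * (((d + 1 : ℕ) : ℝ) + 1) ^ 3 * ϱ')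
      * (1 + 8 * (2097152 * (((d + 1 : ℕ) : ℝ) + 1) ^ 2) * ϱ) ≤ 2)
    (hc₃ : 2 * ϱ ≤ c3 (d + 1) (ℓ + 1) / 4)
    (hβ₀ : 3 * (((((ℓ + 1 : ℕ) : ℝ)) ^ 3)⁻¹ * β₀) ≤ ϱ')
    (hunitA : ∀ j (α₀ : ℝ) (U : CfgY (Matrix (Fin N) (Fin N) ℂ) (f j).toKIdx), MInv ≤ (geo9Y (f j)).M → 0 < α₀ → (geo9Y (f j)).M * α₀ ≤ aInv →
      (bg9YC (Matrix (Fin N) (Fin N) ℂ) G (extraYPb (Matrix (Fin N) (Fin N) ℂ) G) (f j)).Reg335 c35 α₀ U →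
      IsUnit (deltaAQY (f j).toKIdx (𝔮 j) (𝔮s j) (parKnitY (f j).toKIdx) (GpY (f j).toKIdx (parKnitY (f j).toKIdx)) U)) (hb₁ : 0 ≤ b₁)
    (hMd : 2 * ((d : ℝ) + 1) < MInv) (mN : ℕ) (hnbr : ∀ (j : J) (y' : IBondY (f j).toKIdx), (nbr (geo9Y (f j)) (2 * ((d : ℝ) + 1)) y').card ≤ mN)
    (hMr : rLB d ℓ + 1 < MInv)
    (h32 : B9.Thm32Printed (d + 1) c35 (fun j => geo9Y (f j)) (fun j => bg9YC (Matrix (Fin N) (Fin N) ℂ) G (extraYPb (Matrix (Fin N) (Fin N) ℂ) G) (f j))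
      (CinvY (extraYPb (Matrix (Fin N) (Fin N) ℂ) G) f G (fun j => parKnitY (f j).toKIdx)))
    (h33 : B9.Thm33Printed c35 (fun j => geo9Y (f j))
      (fun j => (codingYx (extraYPb (Matrix (Fin N) (Fin N) ℂ) G) G (f j)
        (C37KY G (f j) (ιB j) (fun α₀ U => (bg9YC (Matrix (Fin N) (Fin N) ℂ) G (extraYPb (Matrix (Fin N) (Fin N) ℂ) G) (f j)).Reg335 c35 α₀ U) Cq CqK MK aInv β₀) (C38 j)).bg)
      (fun j => KSCUPar (extraYPb (Matrix (Fin N) (Fin N) ℂ) G) G (f j) (parKnitY (f j).toKIdx) (parSymY (f j).toKIdx)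
        (C37KY G (f j) (ιB j) (fun α₀ U => (bg9YC (Matrix (Fin N) (Fin N) ℂ) G (extraYPb (Matrix (Fin N) (Fin N) ℂ) G) (f j)).Reg335 c35 α₀ U) Cq CqK MK aInv β₀) (C38 j))
      (fun j => KACU (extraYPb (Matrix (Fin N) (Fin N) ℂ) G) G (f j)
        (GAQY (f j).toKIdx (𝔮 j) (𝔮s j) (parKnitY (f j).toKIdx) (GpY (f j).toKIdx (parKnitY (f j).toKIdx))) (parBY (f j).toKIdx)
        (C37KY G (f j) (ιB j) (fun α₀ U => (bg9YC (Matrix (Fin N) (Fin N) ℂ) G (extraYPb (Matrix (Fin N) (Fin N) ℂ) G) (f j)).Reg335 c35 α₀ U) Cq CqK MK aInv β₀) (C38 j))) :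
    SectBStepUPar (extraYPb (Matrix (Fin N) (Fin N) ℂ) G) f (d + 1) c35 G b (fun j => parKnitY (f j).toKIdx) (fun j => parSymY (f j).toKIdx)
      (fun j => GAQY (f j).toKIdx (𝔮 j) (𝔮s j) (parKnitY (f j).toKIdx) (GpY (f j).toKIdx (parKnitY (f j).toKIdx)))
      (fun j => parBY (f j).toKIdx)
      (fun j => C37KY G (f j) (ιB j) (fun α₀ U => (bg9YC (Matrix (Fin N) (Fin N) ℂ) G (extraYPb (Matrix (Fin N) (Fin N) ℂ) G) (f j)).Reg335 c35 α₀ U) Cq CqK MK aInv β₀)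
      C38 (CinvY (extraYPb (Matrix (Fin N) (Fin N) ℂ) G) f G (fun j => parKnitY (f j).toKIdx)) := by
  obtain ⟨hα3, -, -⟩ := windows_of_alphaQ (D := d + 1) hL.2 (Nat.succ_pos d) hα' hαQ
  have hcA : (0 : ℝ) ≤ ((((ℓ + 1 : ℕ) : ℝ)) ^ 3)⁻¹ := by positivity
  -- the three displayed laws of `hQ80_knit` at the pinned knit class
  have hC37R := hC37R_of_C37KY f c35 G (extraYPb (Matrix (Fin N) (Fin N) ℂ) G) ιB Cq CqK MK aInv β₀
  have hC37A := hC37A_of_C37KY f G ιB Cq CqK MK aInv β₀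
    (fun j α₀ U => (bg9YC (Matrix (Fin N) (Fin N) ℂ) G (extraYPb (Matrix (Fin N) (Fin N) ℂ) G) (f j)).Reg335 c35 α₀ U)
  have hC37ϱ := hC37ϱ_of_C37KY f G ιB Cq CqK MK aInv β₀
    (fun j α₀ U => (bg9YC (Matrix (Fin N) (Fin N) ℂ) G (extraYPb (Matrix (Fin N) (Fin N) ℂ) G) (f j)).Reg335 c35 α₀ U) hβ₀
  have hQ80 := hQ80_knit (Mstar := Mstar) (extraYPb (Matrix (Fin N) (Fin N) ℂ) G) f c35 G 𝔮 𝔮s b ιB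
    (fun j => C37KY G (f j) (ιB j) (fun α₀ U => (bg9YC (Matrix (Fin N) (Fin N) ℂ) G (extraYPb (Matrix (Fin N) (Fin N) ℂ) G) (f j)).Reg335 c35 α₀ U) Cq CqK MK aInv β₀)
    hGU hι hM₂ hrepr h𝔮 h𝔮s hc hRP hα' hα3 hα8 hKpl hϱ' hϱ hsmall' hc₃' hϱ'1 hE hdX hsmall hc₃ hcA hC37R hC37A hC37ϱ
  have hQL280 := hQL280_knit (Mstar := Mstar) (extraYPb (Matrix (Fin N) (Fin N) ℂ) G) f c35 G 𝔮 𝔮s b ιB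
    (fun j => C37KY G (f j) (ιB j) (fun α₀ U => (bg9YC (Matrix (Fin N) (Fin N) ℂ) G (extraYPb (Matrix (Fin N) (Fin N) ℂ) G) (f j)).Reg335 c35 α₀ U) Cq CqK MK aInv β₀)
    hGU hι hM₂ hrepr h𝔮 h𝔮s hc hRP hα' hα3 hα8 hKpl hϱ' hϱ hsmall' hc₃' hϱ'1 hE hdX hsmall hc₃ hcA hC37R hC37A hC37ϱ
  have hb0 : 0 ≤ ∑ j, ‖b j‖ := Finset.sum_nonneg fun _ _ => norm_nonneg _
  have hcF : 0 ≤ (M₂ * ∑ j, ‖b j‖) * ((N : ℝ) ^ 4 * (9 / (2 * ϱ') * (2 * ((d : ℝ) + 1))) * ((((ℓ + 1 : ℕ) : ℝ)) ^ 3)⁻¹) *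
      Real.exp ((ℓ : ℝ) + 4) := by positivity
  have hcF2 : 0 ≤ (Real.sqrt (Fintype.card ι) * M₂ * ∑ j, ‖b j‖) * ((N : ℝ) ^ 4 * (9 / (2 * ϱ') * (2 * ((d : ℝ) + 1))) * ((((ℓ + 1 : ℕ) : ℝ)) ^ 3)⁻¹) *
      Real.exp ((ℓ : ℝ) + 4) := by positivity
  exact sectBStepUPar_knit_of_lawsAt f c35 G 𝔮 𝔮s b ιB C38
    (fun j α₀ U => (bg9YC (Matrix (Fin N) (Fin N) ℂ) G (extraYPb (Matrix (Fin N) (Fin N) ℂ) G) (f j)).Reg335 c35 α₀ U) Cq CqK MK aInv β₀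
    hι hGa hGU M₂ hM₂ hrepr hcR hcL h𝔮 h𝔮s hCqK MInv aInv aW hMInv haInv haW hc hRP hα' hαQ hαt hKpl hunitA hb₁ _ hcF hQ80 _ hcF2 hQL280
    hMd mN hnbr hMr h32 h33


end Full

/-! ## §2 At the stage record, `G := SU(N)`, EVERY `N` -/

section Record

variable {N : ℕ} [Nonempty (Fin N)] (θ : Stage3Params) (Mstar : ℕ)
variable {ι : Type} [Fintype ι] [DecidableEq ι]
variable {J : Type} (f : J → MemberY θ.d₆ θ.ℓ₆ θ.hd' θ.hL' θ.b₀ θ.b₁ Mstar)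
  [∀ x : MemberY θ.d₆ θ.ℓ₆ θ.hd' θ.hL' θ.b₀ θ.b₁ Mstar, Fintype (geo9Y x).Site]
  [instDS : ∀ x : MemberY θ.d₆ θ.ℓ₆ θ.hd' θ.hL' θ.b₀ θ.b₁ Mstar, DecidableEq (geo9Y x).Site]
  [instNE : ∀ x : MemberY θ.d₆ θ.ℓ₆ θ.hd' θ.hL' θ.b₀ θ.b₁ Mstar, Nonempty (geo9Y x).Site]
  (b : Module.Basis ι ℝ (Matrix (Fin N) (Fin N) ℂ)) (ιB : ∀ j : J, BlkY (f j).toKIdx → IBondY (f j).toKIdx)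
  (C38 : ∀ j : J, ℝ → CfgY (Matrix (Fin N) (Fin N) ℂ) (f j).toKIdx → AfldY (Matrix (Fin N) (Fin N) ℂ) (f j).toKIdx → Prop)
  (CqK MK aInv : ℝ)


/-- ★★★ **THE KNIT SECT.-B STEP AT THE STAGE RECORD FOR EVERY `N`** («K2-G-KNIT-N» edition of `sectBStepUPar_knitRecord`: the LOCATED-RANGE `hN : N ≤ 25` REPLACED by dag-n06-l's two x-free windows `hα4N : 32((d+1)+1)((d+1)+4)(ℓ+1)²α₀′ ≤ 1∕4`, `hαπN : N·(…) < π`, through `B7Prop2SpecialUnitary.avgClosedAt_specialUnitary` and `sectBStepUPar_knitAt`; `G := SU(N)`; `c35 := c35Y`; the averaging pair of record; `P := extraYPb`; class `C37KY` pinned to the coded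
regularity `(bg9YC 𝕄 SU(N) extraYPb x).Reg335 c35Y`, straight constant `Cq := cqY d₆` (node00-def-Y's word I.20728), exponent window
`β₀ := ϱ′·L³∕3`, the knit constant `CqK` and the thresholds `MK ∕ aInv` binders): from the record's Theorem 3.2 `h32` and the record-level Theorem 3.3 `h33` for
`(G′, G) = (GpY parKnitY, G[𝔮_rec](parKnitY, G′))` read by `kernelFamilyS … parSymY ∕ kernelFamilyB … parBY` — the two antecedents of «KA»'s `hBK` — plus the GUARDED knit
Thm 3.11 unit `hunitA`, the numerics windows and the basis data, the two-transporter Sect.-B step over the coded carrier at the knit.  Everything else is discharged by name in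
`sectBStepUPar_knit` (gen 26) and its companions. [cite: Balaban1985BackgroundPropagators, Thm 3.4 p.400, Sect. B pp.400–407, (3.19) p.393, (3.35)–(3.37) p.396, Thms 3.2–3.3 pp.398–399, Thm 3.11 p.416; Balaban1985Averaging, Prop. 2 p.26, Prop. 7 p.43; Balaban1984PropagatorsII, Lemma 2.1 p.234] -/
theorem sectBStepUPar_knitRecordN [NormOneClass (Matrix (Fin N) (Fin N) ℂ)] [FiniteDimensional ℝ (Matrix (Fin N) (Fin N) ℂ)]
    (hι : ∀ (j : J) (s : BlkY (f j).toKIdx), β (f j).toKIdx.hN (f j).toKIdx.D (f j).toKIdx.hk (ιB j s) = s)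
    (M₂ : ℝ) (hM₂ : 0 ≤ M₂) (hrepr : ∀ (v : Matrix (Fin N) (Fin N) ℂ) (j : ι), |b.repr v j| ≤ M₂ * ‖v‖) (hcR : 0 < M₂ * ∑ j, ‖b j‖)
    (hcL : 0 < Real.sqrt (Fintype.card ι) * M₂ * ∑ j, ‖b j‖)
    (hCqK : 0 ≤ CqK) (MInv aW : ℝ) (hMInv : 0 < MInv) (haInv : 0 < aInv) (haW : 0 < aW)
    {α₀' : ℝ} (hα' : 0 < α₀') (hαQ : α₀' ≤ alphaQ (θ.d₆ + 1) (θ.ℓ₆ + 1)) (hα8 : 8 * α₀' ≤ c2' (θ.d₆ + 1) (θ.ℓ₆ + 1))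
    (hα4N : 32 * (((θ.d₆ + 1 : ℕ) : ℝ) + 1) * ((θ.d₆ + 1 : ℕ) + 4) * (((θ.ℓ₆ + 1 : ℕ) : ℝ)) ^ 2 * α₀' ≤ 1 / 4) (hαπN : (N : ℝ) * (32 * (((θ.d₆ + 1 : ℕ) : ℝ) + 1) * ((θ.d₆ + 1 : ℕ) + 4) * (((θ.ℓ₆ + 1 : ℕ) : ℝ)) ^ 2 * α₀') < Real.pi)
    (hKpl : ∀ (j : J) (a : ℝ), 0 ≤ a → a ≤ aInv → Kpl (f j).toKIdx a * (kGeo (f j).toKIdx).L ^ 4 < α₀')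
    {ϱ' ϱ : ℝ} (hϱ' : 0 < ϱ') (hϱ : 0 < ϱ)
    (hsmall' : Real.exp (4 * (800 * (((θ.d₆ + 1 : ℕ) : ℝ) + 1) ^ 2 * (((θ.d₆ + 1 : ℕ) : ℝ) + 4)) * α₀')
      * (1 + 8 * (131072 * (((θ.d₆ + 1 : ℕ) : ℝ) + 1) ^ 2) * ϱ') ≤ 2)
    (hc₃' : 2 * ϱ' ≤ c3 (θ.d₆ + 1) (θ.ℓ₆ + 1)) (hϱ'1 : 409600 * (((θ.d₆ + 1 : ℕ) : ℝ) + 1) ^ 2 * ϱ' ≤ 1)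
    (hE : epsCplx (θ.d₆ + 1) (θ.ℓ₆ + 1) ϱ' 0 ≤ 1 / 16)
    (hdX : ((θ.d₆ + 1 : ℕ) : ℝ) * (epsCplx (θ.d₆ + 1) (θ.ℓ₆ + 1) ϱ' 0 + tauCplx (θ.d₆ + 1) (θ.ℓ₆ + 1) α₀' 0 ϱ' 0) ≤ 1 / 16)
    (hsmall : Real.exp (4480 * (((θ.d₆ + 1 : ℕ) : ℝ) + 1) ^ 2 * (((θ.d₆ + 1 : ℕ) : ℝ) + 4) * α₀' + 240000 * (((θ.d₆ + 1 : ℕ) : ℝ) + 1) ^ 3 * ϱ')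
      * (1 + 8 * (2097152 * (((θ.d₆ + 1 : ℕ) : ℝ) + 1) ^ 2) * ϱ) ≤ 2)
    (hc₃ : 2 * ϱ ≤ c3 (θ.d₆ + 1) (θ.ℓ₆ + 1) / 4)
    (hunitA : ∀ j (α₀ : ℝ) (U : CfgY (Matrix (Fin N) (Fin N) ℂ) (f j).toKIdx), MInv ≤ (geo9Y (f j)).M → 0 < α₀ → (geo9Y (f j)).M * α₀ ≤ aInv →
      (bg9YC (Matrix (Fin N) (Fin N) ℂ) (specialUnitaryUnits (Fin N)) (extraYPb (Matrix (Fin N) (Fin N) ℂ) (specialUnitaryUnits (Fin N))) (f j)).Reg335 c35Y α₀ U →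
      IsUnit (deltaAQY (f j).toKIdx (qKnitOfRecord N θ (f j).toKIdx) (qsKnitOfRecord N θ (f j).toKIdx) (parKnitY (f j).toKIdx)
        (GpY (f j).toKIdx (parKnitY (f j).toKIdx)) U))
    (hMd : 2 * ((θ.d₆ : ℝ) + 1) < MInv) (mN : ℕ) (hnbr : ∀ (j : J) (y' : IBondY (f j).toKIdx), (nbr (geo9Y (f j)) (2 * ((θ.d₆ : ℝ) + 1)) y').card ≤ mN)
    (hMr : rLB θ.d₆ θ.ℓ₆ + 1 < MInv)
    (h32 : B9.Thm32Printed (θ.d₆ + 1) c35Y (fun j => geo9Y (f j))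
      (fun j => bg9YC (Matrix (Fin N) (Fin N) ℂ) (specialUnitaryUnits (Fin N)) (extraYPb (Matrix (Fin N) (Fin N) ℂ) (specialUnitaryUnits (Fin N))) (f j))
      (CinvY (extraYPb (Matrix (Fin N) (Fin N) ℂ) (specialUnitaryUnits (Fin N))) f (specialUnitaryUnits (Fin N)) (fun j => parKnitY (f j).toKIdx)))
    (h33 : B9.Thm33Printed c35Y (fun j => geo9Y (f j))
      (fun j => bg9YC (Matrix (Fin N) (Fin N) ℂ) (specialUnitaryUnits (Fin N)) (extraYPb (Matrix (Fin N) (Fin N) ℂ) (specialUnitaryUnits (Fin N))) (f j))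
      (fun j => kernelFamilyS (f j).toKIdx
        (bg9YC (Matrix (Fin N) (Fin N) ℂ) (specialUnitaryUnits (Fin N)) (extraYPb (Matrix (Fin N) (Fin N) ℂ) (specialUnitaryUnits (Fin N))) (f j)) (fun U => U)
        (GpY (f j).toKIdx (parKnitY (f j).toKIdx)) (parSymY (f j).toKIdx))
      (fun j => kernelFamilyB (f j).toKIdx
        (bg9YC (Matrix (Fin N) (Fin N) ℂ) (specialUnitaryUnits (Fin N)) (extraYPb (Matrix (Fin N) (Fin N) ℂ) (specialUnitaryUnits (Fin N))) (f j)) (fun U => U)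
        (GAQY (f j).toKIdx (qKnitOfRecord N θ (f j).toKIdx) (qsKnitOfRecord N θ (f j).toKIdx) (parKnitY (f j).toKIdx) (GpY (f j).toKIdx (parKnitY (f j).toKIdx)))
        (parBY (f j).toKIdx))) :
    SectBStepUPar (extraYPb (Matrix (Fin N) (Fin N) ℂ) (specialUnitaryUnits (Fin N))) f (θ.d₆ + 1) c35Y (specialUnitaryUnits (Fin N)) b
      (fun j => parKnitY (f j).toKIdx) (fun j => parSymY (f j).toKIdx)
      (fun j => GAQY (f j).toKIdx (qKnitOfRecord N θ (f j).toKIdx) (qsKnitOfRecord N θ (f j).toKIdx) (parKnitY (f j).toKIdx) (GpY (f j).toKIdx (parKnitY (f j).toKIdx)))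
      (fun j => parBY (f j).toKIdx)
      (fun j => C37KY (specialUnitaryUnits (Fin N)) (f j) (ιB j)
        (fun α₀ U => (bg9YC (Matrix (Fin N) (Fin N) ℂ) (specialUnitaryUnits (Fin N)) (extraYPb (Matrix (Fin N) (Fin N) ℂ) (specialUnitaryUnits (Fin N))) (f j)).Reg335 c35Y α₀ U)
        (cqY θ.d₆) CqK MK aInv (ϱ' * (((θ.ℓ₆ + 1 : ℕ) : ℝ)) ^ 3 / 3))
      C38 (CinvY (extraYPb (Matrix (Fin N) (Fin N) ℂ) (specialUnitaryUnits (Fin N))) f (specialUnitaryUnits (Fin N)) (fun j => parKnitY (f j).toKIdx)) := by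
  have hb₁ : 0 ≤ θ.b₁ := θ.hb.1.le.trans θ.hb.2
  have hL0 : (0 : ℝ) < (((θ.ℓ₆ + 1 : ℕ) : ℝ)) := by positivity
  have hβ₀ : 3 * (((((θ.ℓ₆ + 1 : ℕ) : ℝ)) ^ 3)⁻¹ * (ϱ' * (((θ.ℓ₆ + 1 : ℕ) : ℝ)) ^ 3 / 3)) ≤ ϱ' := by
    have : 3 * (((((θ.ℓ₆ + 1 : ℕ) : ℝ)) ^ 3)⁻¹ * (ϱ' * (((θ.ℓ₆ + 1 : ℕ) : ℝ)) ^ 3 / 3)) = ϱ' := by field_simp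
    rw [this]
  -- the regime bridge: the coded class of record is print's class with `0 ≤ α₀`; its first conjunct is the local class at the member's own index
  have hRP : ∀ (j : J) (α₀ : ℝ) (U : CfgY (Matrix (Fin N) (Fin N) ℂ) (f j).toKIdx),
      (bg9YC (Matrix (Fin N) (Fin N) ℂ) (specialUnitaryUnits (Fin N)) (extraYPb (Matrix (Fin N) (Fin N) ℂ) (specialUnitaryUnits (Fin N))) (f j)).Reg335 c35Y α₀ U →
        (bg9KP (Matrix (Fin N) (Fin N) ℂ) (specialUnitaryUnits (Fin N)) (f j).toKIdx).Reg335 c35Y α₀ U :=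
    fun j α₀ U hU => ⟨hU.1.1, hU.1.2.2⟩
  exact sectBStepUPar_knitAt f c35Y (specialUnitaryUnits (Fin N)) (fun j => qKnitOfRecord N θ (f j).toKIdx) (fun j => qsKnitOfRecord N θ (f j).toKIdx) b ιB C38
    (cqY θ.d₆) CqK MK aInv (ϱ' * (((θ.ℓ₆ + 1 : ℕ) : ℝ)) ^ 3 / 3) hι
    (avgClosedAt_specialUnitary (θ.d₆ + 1) (θ.ℓ₆ + 1) hα4N (by simpa only [Fintype.card_fin] using hαπN)) specialUnitaryUnits_le_unitaryUnits M₂ hM₂ hrepr hcR hcL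
    (fun j U => rfl) (fun j U => rfl) hCqK MInv aW hMInv haInv haW c35Y_le_ten hRP hα' hαQ le_rfl hα8 hKpl hϱ' hϱ hsmall' hc₃' hϱ'1 hE hdX hsmall hc₃ hβ₀
    hunitA hb₁ hMd mN hnbr hMr h32
    (thm33Printed_codedUPar (extraYPb (Matrix (Fin N) (Fin N) ℂ) (specialUnitaryUnits (Fin N))) (specialUnitaryUnits (Fin N)) f C38
      (fun j => parKnitY (f j).toKIdx) (fun j => parSymY (f j).toKIdx)
      (fun j => GAQY (f j).toKIdx (qKnitOfRecord N θ (f j).toKIdx) (qsKnitOfRecord N θ (f j).toKIdx) (parKnitY (f j).toKIdx) (GpY (f j).toKIdx (parKnitY (f j).toKIdx)))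
      (fun j => parBY (f j).toKIdx) c35Y _ h33)


/-- ★★★ **THE KNIT SECT.-B STEP OF RECORD IN THE CERTIFICATE's CURRENCY, FOR EVERY `N`** («K2-G-KNIT-N» edition of `sectBStepUPar_knitRecordKC`: `hN : N ≤ 25` ↦ `hα4N hαπN` at the certificate's `α₀K`) — `sectBStepUPar_knitRecordN` (`G := SU(N)`; `c35 := c35Y`; the averaging pair of record;
`P := extraYPb`; class token `C37KY SU(N) (f j) (ιB j) ((bg9YC … extraYPb (f j)).Reg335 c35Y) (cqY d₆) CqK MK aInv (ϱ′·L³∕3)`) with the guarded knit Thm 3.11 unit `hunitA`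
DISCHARGED from the certificate's displayed row-17 law `hΔAK` (symmetry and positivity of `Δ_a^Q(U)` over (3.115)'s `Q` and the knit contours, in the certificate's regime currency
`(R₁, R₂, c)` with `aR` for its `q.a₁∕c`) through its class bridge `hP1` and `isUnit_of_posDefTr` (print: «positive, hence invertible»), on `MR ≤ MInv`, `aInv ≤ aR`; the
plaquette threshold READ from the certificate's index-keyed `hKplK` on `aInv ≤ aK`; the α-window spelled at the certificate's `α₀K`.
[cite: Balaban1985BackgroundPropagators, Thm 3.4 p.400, Thm 3.11 p.416, (3.24)–(3.25) p.395, (3.19) p.393, (3.35)–(3.37) p.396, Thms 3.2–3.3 pp.398–399; Balaban1985Averaging, Prop. 2 p.26, Prop. 7 p.43; Balaban1984PropagatorsII, Lemma 2.1 p.234] -/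
theorem sectBStepUPar_knitRecordKCN [NormOneClass (Matrix (Fin N) (Fin N) ℂ)] [FiniteDimensional ℝ (Matrix (Fin N) (Fin N) ℂ)]
    (hι : ∀ (j : J) (s : BlkY (f j).toKIdx), β (f j).toKIdx.hN (f j).toKIdx.D (f j).toKIdx.hk (ιB j s) = s)
    (M₂ : ℝ) (hM₂ : 0 ≤ M₂) (hrepr : ∀ (v : Matrix (Fin N) (Fin N) ℂ) (j : ι), |b.repr v j| ≤ M₂ * ‖v‖) (hcR : 0 < M₂ * ∑ j, ‖b j‖)
    (hcL : 0 < Real.sqrt (Fintype.card ι) * M₂ * ∑ j, ‖b j‖)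
    (hCqK : 0 ≤ CqK) (MInv aW : ℝ) (hMInv : 0 < MInv) (haInv : 0 < aInv) (haW : 0 < aW)
    {R₁ R₂ : RegFamY θ.d₆ θ.ℓ₆ θ.hd' θ.hL' θ.b₀ θ.b₁ Mstar (Matrix (Fin N) (Fin N) ℂ)} (c : ℝ)
    (hP1 : ClassIncl (regYP335 (Matrix (Fin N) (Fin N) ℂ) (specialUnitaryUnits (Fin N))) c35Y R₁ c) (MR aR : ℝ)
    (hΔAK : ∀ x : MemberY θ.d₆ θ.ℓ₆ θ.hd' θ.hL' θ.b₀ θ.b₁ Mstar, MR ≤ (geo9Y x).M → ∀ α₀ : ℝ, 0 < α₀ → (geo9Y x).M * α₀ ≤ aR →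
      ∀ U : (bg9YR (Matrix (Fin N) (Fin N) ℂ) (specialUnitaryUnits (Fin N)) R₁ R₂ x).Cfg, (bg9YR (Matrix (Fin N) (Fin N) ℂ) (specialUnitaryUnits (Fin N)) R₁ R₂ x).Reg335 c α₀ U →
        IsSymmTr (fun _ => (1 : ℝ)) (deltaAQY x.toKIdx (qKnitOfRecord N θ x.toKIdx) (qsKnitOfRecord N θ x.toKIdx) (parKnitY x.toKIdx) (GpY x.toKIdx (parKnitY x.toKIdx)) U) ∧
          PosDefTr (fun _ => (1 : ℝ)) (deltaAQY x.toKIdx (qKnitOfRecord N θ x.toKIdx) (qsKnitOfRecord N θ x.toKIdx) (parKnitY x.toKIdx) (GpY x.toKIdx (parKnitY x.toKIdx)) U))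
    (hMRI : MR ≤ MInv) (haIR : aInv ≤ aR)
    {α₀K aK : ℝ} (hαK : 0 < α₀K) (hαQ : α₀K ≤ alphaQ (θ.d₆ + 1) (θ.ℓ₆ + 1)) (hα8 : 8 * α₀K ≤ c2' (θ.d₆ + 1) (θ.ℓ₆ + 1))
    (hα4N : 32 * (((θ.d₆ + 1 : ℕ) : ℝ) + 1) * ((θ.d₆ + 1 : ℕ) + 4) * (((θ.ℓ₆ + 1 : ℕ) : ℝ)) ^ 2 * α₀K ≤ 1 / 4) (hαπN : (N : ℝ) * (32 * (((θ.d₆ + 1 : ℕ) : ℝ) + 1) * ((θ.d₆ + 1 : ℕ) + 4) * (((θ.ℓ₆ + 1 : ℕ) : ℝ)) ^ 2 * α₀K) < Real.pi)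
    (hKplK : ∀ (i : KIdx θ.d₆ θ.ℓ₆ θ.hd' θ.hL' θ.b₀ θ.b₁) (a : ℝ), 0 ≤ a → a ≤ aK → Kpl i a * (kGeo i).L ^ 4 < α₀K) (haIK : aInv ≤ aK)
    {ϱ' ϱ : ℝ} (hϱ' : 0 < ϱ') (hϱ : 0 < ϱ)
    (hsmall' : Real.exp (4 * (800 * (((θ.d₆ + 1 : ℕ) : ℝ) + 1) ^ 2 * (((θ.d₆ + 1 : ℕ) : ℝ) + 4)) * α₀K)
      * (1 + 8 * (131072 * (((θ.d₆ + 1 : ℕ) : ℝ) + 1) ^ 2) * ϱ') ≤ 2)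
    (hc₃' : 2 * ϱ' ≤ c3 (θ.d₆ + 1) (θ.ℓ₆ + 1)) (hϱ'1 : 409600 * (((θ.d₆ + 1 : ℕ) : ℝ) + 1) ^ 2 * ϱ' ≤ 1)
    (hE : epsCplx (θ.d₆ + 1) (θ.ℓ₆ + 1) ϱ' 0 ≤ 1 / 16)
    (hdX : ((θ.d₆ + 1 : ℕ) : ℝ) * (epsCplx (θ.d₆ + 1) (θ.ℓ₆ + 1) ϱ' 0 + tauCplx (θ.d₆ + 1) (θ.ℓ₆ + 1) α₀K 0 ϱ' 0) ≤ 1 / 16)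
    (hsmall : Real.exp (4480 * (((θ.d₆ + 1 : ℕ) : ℝ) + 1) ^ 2 * (((θ.d₆ + 1 : ℕ) : ℝ) + 4) * α₀K + 240000 * (((θ.d₆ + 1 : ℕ) : ℝ) + 1) ^ 3 * ϱ')
      * (1 + 8 * (2097152 * (((θ.d₆ + 1 : ℕ) : ℝ) + 1) ^ 2) * ϱ) ≤ 2)
    (hc₃ : 2 * ϱ ≤ c3 (θ.d₆ + 1) (θ.ℓ₆ + 1) / 4)
    (hMd : 2 * ((θ.d₆ : ℝ) + 1) < MInv) (mN : ℕ) (hnbr : ∀ (j : J) (y' : IBondY (f j).toKIdx), (nbr (geo9Y (f j)) (2 * ((θ.d₆ : ℝ) + 1)) y').card ≤ mN)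
    (hMr : rLB θ.d₆ θ.ℓ₆ + 1 < MInv)
    (h32 : B9.Thm32Printed (θ.d₆ + 1) c35Y (fun j => geo9Y (f j))
      (fun j => bg9YC (Matrix (Fin N) (Fin N) ℂ) (specialUnitaryUnits (Fin N)) (extraYPb (Matrix (Fin N) (Fin N) ℂ) (specialUnitaryUnits (Fin N))) (f j))
      (CinvY (extraYPb (Matrix (Fin N) (Fin N) ℂ) (specialUnitaryUnits (Fin N))) f (specialUnitaryUnits (Fin N)) (fun j => parKnitY (f j).toKIdx)))
    (h33 : B9.Thm33Printed c35Y (fun j => geo9Y (f j))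
      (fun j => bg9YC (Matrix (Fin N) (Fin N) ℂ) (specialUnitaryUnits (Fin N)) (extraYPb (Matrix (Fin N) (Fin N) ℂ) (specialUnitaryUnits (Fin N))) (f j))
      (fun j => kernelFamilyS (f j).toKIdx
        (bg9YC (Matrix (Fin N) (Fin N) ℂ) (specialUnitaryUnits (Fin N)) (extraYPb (Matrix (Fin N) (Fin N) ℂ) (specialUnitaryUnits (Fin N))) (f j)) (fun U => U)
        (GpY (f j).toKIdx (parKnitY (f j).toKIdx)) (parSymY (f j).toKIdx))
      (fun j => kernelFamilyB (f j).toKIdx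
        (bg9YC (Matrix (Fin N) (Fin N) ℂ) (specialUnitaryUnits (Fin N)) (extraYPb (Matrix (Fin N) (Fin N) ℂ) (specialUnitaryUnits (Fin N))) (f j)) (fun U => U)
        (GAQY (f j).toKIdx (qKnitOfRecord N θ (f j).toKIdx) (qsKnitOfRecord N θ (f j).toKIdx) (parKnitY (f j).toKIdx) (GpY (f j).toKIdx (parKnitY (f j).toKIdx)))
        (parBY (f j).toKIdx))) :
    SectBStepUPar (extraYPb (Matrix (Fin N) (Fin N) ℂ) (specialUnitaryUnits (Fin N))) f (θ.d₆ + 1) c35Y (specialUnitaryUnits (Fin N)) b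
      (fun j => parKnitY (f j).toKIdx) (fun j => parSymY (f j).toKIdx)
      (fun j => GAQY (f j).toKIdx (qKnitOfRecord N θ (f j).toKIdx) (qsKnitOfRecord N θ (f j).toKIdx) (parKnitY (f j).toKIdx) (GpY (f j).toKIdx (parKnitY (f j).toKIdx)))
      (fun j => parBY (f j).toKIdx)
      (fun j => C37KY (specialUnitaryUnits (Fin N)) (f j) (ιB j)
        (fun α₀ U => (bg9YC (Matrix (Fin N) (Fin N) ℂ) (specialUnitaryUnits (Fin N)) (extraYPb (Matrix (Fin N) (Fin N) ℂ) (specialUnitaryUnits (Fin N))) (f j)).Reg335 c35Y α₀ U)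
        (cqY θ.d₆) CqK MK aInv (ϱ' * (((θ.ℓ₆ + 1 : ℕ) : ℝ)) ^ 3 / 3))
      C38 (CinvY (extraYPb (Matrix (Fin N) (Fin N) ℂ) (specialUnitaryUnits (Fin N))) f (specialUnitaryUnits (Fin N)) (fun j => parKnitY (f j).toKIdx)) := by
  -- «KC»'s own bridge `h1U`: the coded class of record at `c35Y` lies in the certificate's class `R₁` at `c` (for `0 < α₀`)
  have h1U : ClassIncl (regC335 (Matrix (Fin N) (Fin N) ℂ) (specialUnitaryUnits (Fin N)) (extraYPb (Matrix (Fin N) (Fin N) ℂ) (specialUnitaryUnits (Fin N)))) c35Y R₁ c :=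
    fun x α₀ U hα h => hP1 x α₀ U hα (classIncl_regC335Pb_regYPb335 c35Y c35Y x α₀ U hα h).2
  -- the guarded knit Thm 3.11 unit from the displayed positivity: «positive, hence invertible»
  have hunitA : ∀ j (α₀ : ℝ) (U : CfgY (Matrix (Fin N) (Fin N) ℂ) (f j).toKIdx), MInv ≤ (geo9Y (f j)).M → 0 < α₀ → (geo9Y (f j)).M * α₀ ≤ aInv →
      (bg9YC (Matrix (Fin N) (Fin N) ℂ) (specialUnitaryUnits (Fin N)) (extraYPb (Matrix (Fin N) (Fin N) ℂ) (specialUnitaryUnits (Fin N))) (f j)).Reg335 c35Y α₀ U →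
      IsUnit (deltaAQY (f j).toKIdx (qKnitOfRecord N θ (f j).toKIdx) (qsKnitOfRecord N θ (f j).toKIdx) (parKnitY (f j).toKIdx)
        (GpY (f j).toKIdx (parKnitY (f j).toKIdx)) U) :=
    fun j α₀ U hM hα ha hU => isUnit_of_posDefTr (hΔAK (f j) (hMRI.trans hM) α₀ hα (ha.trans haIR) U (h1U (f j) α₀ U hα hU)).2
  exact sectBStepUPar_knitRecordN θ Mstar f b ιB C38 CqK MK aInv hι M₂ hM₂ hrepr hcR hcL hCqK MInv aW hMInv haInv haW hαK hαQ hα8 hα4N hαπN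
    (fun j a h0 ha => hKplK (f j).toKIdx a h0 (ha.trans haIK)) hϱ' hϱ hsmall' hc₃' hϱ'1 hE hdX hsmall hc₃ hunitA hMd mN hnbr hMr h32 h33


end Record

end Summit.QuantumFields.YangMills.BalabanUVNodes.N06SectBStepUParKnitRecordN

end
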